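import Summits.Parity.GeneralizedHardyLittlewood.Theorems.LiouvilleShiftedTablesDefs
import Summits.Parity.GeneralizedHardyLittlewood.Theorems.LiouvilleShiftedTablesBVLiouville

/-!
# Line `peel-to-drappeau` — skeleton v7 for the crux `TypeI2Dilated` (stmt-Parity-14272)

Route `LiouvilleShiftedTables` (Parity / GeneralizedHardyLittlewood), crux decl
`Summit.Parity.GeneralizedHardyLittlewood.Theses.LiouvilleShiftedTables.TypeI2Dilated` (rank 4): for `c ≠ 0`
there is `ρ > 0` with `∑_{q ≤ x^ρ} ∑_{r ≤ R} |∑_{s ≤ S} ∑_{n ≤ y/(sr), rsn ≡ w (q)} λ(rsn + c)| ≤ C x/(log x)^A`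
for `R ≤ x^ρ`, `S R ≤ x^{1/2+ρ}`, `y ≤ x`.

Idea (card `Ideas/peel-to-drappeau.md`, line card `Lines/peel-to-drappeau.md`): peel both rough moduli (`r`
and the dilation `q`) onto the sequence side so that the dispersion only sees the smooth modulus `s ⊥ qrc`;
there Drappeau 2017 Thm 5.1 (hypothesis-free, power-saving `𝔲_R`-dispersion) is the Type-II engine; the
subtracted small-conductor characters come back as a double-family Bombieri–Vinogradov mean value for `λ`.

## Stubs (registered on stmt-Parity-14272 by the lead; v3 reshaping of the planner's six; v4: `DilatedMainTerms` carries the smooth-part index `P` after the assembly audit)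

* `stub_facts : LineFacts` — `DrappeauTypeII ∧ DilatedDivisorAP`, abbreviations of the Literature named facts
  `Drappeau2017_theorem51` (p72040) and `FouvryTenenbaum2021_lemma412 ∧ …_lemma413` (p72050): deep published
  theorems; the crux closes MODULO them (conditional-result) — this stub is discharged only by proofs of the facts.
* `stub_bvLiouville : BVLiouville` — the route's support item stmt-Parity-13324 (BV for `λ`), from the tree's
  PROVED `bombieriVinogradov_moebius` (per-modulus heights) via `λ = 𝟙_□ ⋆ μ`.
* `stub_peel : PeelStep := DrappeauTypeII → DilatedTypeIICore` — THE PEEL, purely arithmetic (v3: the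
  hyperbolic window moved out into `stub_window`).
* `stub_window : WindowStep := DilatedTypeIICore → DilatedTypeII` — separation of the window `Ylo < mn ≤ Yhi`
  at logarithmic cost by a finite Fourier series in `log(mn)` (transition width `x^{−3ρ₀}`, strips trivially).
* `stub_mainTerms : MainTermsStep := BVLiouville → DilatedMainTerms` — the double-family BV for `λ` (lead's stub).
* `stub_uRBound : URBound` — the `𝔲_R` terms of the assembly (Heath-Brown for `μ` + trichotomy; v6, wave 2).
* `stub_assembleFrom : AssembleFrom := URBound → AssembleStep` — the assembly minus its heart (PROVED by w-assemble
  modulo the v6 refactor and landing).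
* `TypeI2Dilated_of : TypeI2Dilated` — kernel-checked composition, concluding the crux BY NAME.

Vocabulary: the line's Defs file `Theorems/LiouvilleShiftedTablesDefs.lean` (p74294, landed) is imported (v7: the
inline prelude of v1–v6 is gone).  Status 2026-08-16T04:40Z: `stub_bvLiouville` LANDED
(`Theorems/LiouvilleShiftedTablesBVLiouville.lean`, p74740 — imported, no longer a `sorry` here); `stub_peel` and
`stub_assembleFrom` PROVED and landing as ≤400-line chains (`…TypeI2DilatedPeel1–6`, `…TypeI2DilatedAssemble1–6`);
`stub_mainTerms` PROVED by the lead modulo one real-inequality lemma, landing as `…TypeI2DilatedMainTerms1–8` +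
`…TypeI2DilatedStubMainTerms`; `stub_window`, `stub_uRBound` with workers.  Each remaining `sorry` below is replaced by
an import of the landed theorem as it is accepted.

Disproof constraints honoured (cdisprove gen-2; Negative/* landed): Siegel–Walfisz strength enters through
`stub_bvLiouville` (used by `stub_mainTerms` below `(log x)^B` and by `stub_assemble` in the BV range) — where the
periodic / `χ₄` / biased-class ghosts die; `y ≤ x` is used in `stub_assemble` (`Y = y + c ≤ 2x`); `∀ A ∃ C`
kept everywhere; every intermediate statement is monotone in `ρ` (`∃ ρ₀ ∀ ρ ≤ ρ₀`).
-/

noncomputable section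

namespace Summit.Parity.GeneralizedHardyLittlewood.Cruxes.TypeI2Dilated.PeelToDrappeau

open Finset Real
open scoped ArithmeticFunction.sigma Classical
open Literature.NumberTheory.Sieve Literature.NumberTheory.Sieve.Drappeau2017
  Literature.NumberTheory.Sieve.FouvryTenenbaum2021
open Summit.Parity.GeneralizedHardyLittlewood.Theses.LiouvilleShiftedTables (TypeI2Dilated BVLiouville)

/-! ### Registered stubs (v7; `stub_bvLiouville` is the landed theorem of `…BVLiouville.lean`) -/

/-- STUB (named facts): `LineFacts = DrappeauTypeII ∧ DilatedDivisorAP` — Drappeau 2017 Thm 5.1 and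
Fouvry–Tenenbaum 2021 Lemmas 4.12–4.13, the Literature named facts `Drappeau2017_theorem51` (p72040) and
`FouvryTenenbaum2021_lemma412 ∧ FouvryTenenbaum2021_lemma413` (p72050).  Deep published theorems (Kuznetsov with
congruence conditions; Weil; Deligne): discharged only by proofs of the facts; until then the crux closes modulo
them (conditional-result). [cite: Drappeau2017, Thm 5.1; FouvryTenenbaum2021, Lemmas 4.12–4.13] -/
theorem stub_facts : LineFacts := by
  sorry

/-- STUB — THE PEEL (`DrappeauTypeII → DilatedTypeIICore`).  PROVED (work/stubs/StubPeel.lean, 1450-line body,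
rc 0 / 0 sorry; landing set work/stubs/peel/): for each `(q, r)` one class `e mod L = lcm(q, r)` (or `0`);
`g := (e, L)`, `L' := L/g`; `g ∣ mn` handled inside the twisted coefficient `α^{(h,ξ)}(m) = 1_{g∣mh} ξ(mh/g) α(m)`;
unit class `mod L'` expanded in `ξ mod L'` (weight `φ(L')⁻¹`; Theorem 5.1 allows arbitrary divisor-bounded
coefficients); `(qr)^∞`-part `h` of the `β`-variable split off (`h ≤ x^{6ρ₀}`, tail by Rankin and
`|𝔲_R(t;s)| ≤ 1_{t=1} + Rd τ(s)/φ(s)` = Drappeau (5.2)); `a₁ := c·qr`, `a₂ := h·qr`, so that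
`𝔲_{Rd}(mn c̄; s) = 𝔲_{Rd}(m'n'' ā₁ a₂; s)`, `{s : (s, a₁a₂) = 1} ∩ (Slo, 2Slo] = sRange c q r Slo (2Slo)` exactly and
`(n'', a₂) = 1` automatically; `ρ₀ := min(δ(η/2), η)/100`.  The `sorry` disappears when the files land.
[cite: Drappeau2017, Thm 5.1, (5.2), Prop 5.3] -/
theorem stub_peel : PeelStep := by
  sorry

/-- STUB — THE WINDOW (`DilatedTypeIICore → DilatedTypeII`): separation of `Ylo < mn ≤ Yhi` by a finite Fourier
series in `log(mn)` (indicator ∗ Fejér on a circle of length `≍ log x`; `∑|c_j| ≪ log x`; twists `m^{iτ_j}`,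
`n^{iτ_j}` absorbed into the coefficients; `DilatedTypeIICore` applied with a uniform bound for every `j`) plus two
transition strips of relative width `x^{−3ρ₀}` bounded trivially (`|𝔲| ≤ 1_{≡} + Rd τ/φ`, divisor bounds):
`x^{2ρ} x^{1−3ρ₀+o(1)} Rd ≤ x^{1+5ρ}/Rd`.  Size: M (delegated, w-window). [this line] -/
theorem stub_window : WindowStep := by
  sorry

/-- STUB — THE DOUBLE-FAMILY BV FOR `λ` (`BVLiouville → DilatedMainTerms`, P-indexed form); plan in the
docstring of `DilatedMainTerms`.  Inputs PROVED in the tree: `LiouvilleMV.sum_lmvTerm_le` (p74339, the `λ`-port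
of `moebius_character_meanValue`), `isPrimitive_crtProd` (p73910), `BVLiouvilleHeights.bv_liouvilleAP` (p74335),
`SiegelWalfiszMoebius_holds(.liouville_progression)`.  The hardest stub of the line (lead's). Size: L.
[cite: Vaughan1980; Drappeau2017, §6] -/
theorem stub_mainTerms : MainTermsStep := by
  sorry

/-- STUB — THE `𝔲_R` TERMS (`URBound`; v6, the analytic heart of the assembly, isolated by the assembly worker's
sub-skeleton): `λ = 1_□ ⋆ μ` (squares `k ≤ x^{2ρ*}`, tail trivially), Heath-Brown's identity for `μ` with
`K = 4` (`Literature.NumberTheory.Sieve.heathBrown_identity_moebius`, p74371), dyadic boxes, Drappeau's trichotomy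
with the greedy refinement: a sub-product in `[x^η, x^{1/3−η}]` (`η = 1/50`) → `DilatedTypeII` (window
`(Y x^{−ρ}, Y]`, classes `c`, `w + c`); else `ν' < x^η` and `ℓ ∈ {1,2,3}` smooth variables `> x^{1/3−η}`:
`ℓ = 1` counting in a progression (+ Pólya–Vinogradov for the subtracted characters, reduced to primitive
`ψ* mod f`, `(D, f) = 1`); `ℓ = 2, 3`: `𝔲_R = gAP − φ⁻¹∑_{1<cond≤Rd} ψ̄(c)ψ` — `gAP` part by
`FouvryTenenbaum2021_lemma412/413` on `x^{−δ/10}`-fine boxes with unit classes `mod lcm(q, rP)` (Möbius for the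
residual coprimality side condition), levels `x^{1/2+ρ} ≤ (x/ν')^{3/5}`, `≤ (x/ν')^{1/2+1/85}`; `ρ₁` depends on
`δ(η/2)` of Theorem 5.1 (through `DilatedTypeII`'s `ρ₀`) and on `δ, C₀` of the FT lemmas.  Size: L (wave 2).
[cite: Drappeau2017, §6; FouvryTenenbaum2021, §§5, 7; Heathbrown1982] -/
theorem stub_uRBound : URBound := by
  sorry

/-- STUB — THE ASSEMBLY minus its heart (`AssembleFrom := URBound → AssembleStep`).  PROVED modulo landing
(work/stubs/StubAssemble.lean by w-assemble, 2298 lines, rc 0; being refactored to the v6 form): (0) the cut at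
`y < x(log x)^{−A−7}`; `m := rsn + c ∈ (c, Y]`, `Y = y + c ≤ 2x`; (1) BV range `s ≤ x^{1/2−5ρ}` via `BVLiouville`
(max class/height per modulus, Cauchy–Schwarz over the `τ₃`-multiplicity); (2) `s = P·s₃` with `P := (s, (qrc)^∞)`,
Rankin tail `P > x^{3ρ}` (power cut — a polylog cut is FALSE for non-unit classes), `r̃ := rP`; (3) exact dyadic
`s₃`-blocks cut from the top; (4) `1_{m ≡ c (s₃)} = mainKernel + uR` (`mainKernel_add_uR_eq_ite`); main part →
`DilatedMainTerms` (P-indexed), `𝔲_R` part → `URBound`. [this line; cite: Drappeau2017, §6] -/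
theorem stub_assembleFrom : AssembleFrom := by
  sorry

/-! ### Composition (kernel-checked; `sorry` enters only through the open `stub_*`) -/

/-- THE SKELETON: the seven registered stubs compose to the crux
`Summit.Parity.GeneralizedHardyLittlewood.Theses.LiouvilleShiftedTables.TypeI2Dilated` BY NAME —
`assembleFrom uRBound (window (peel facts.1)) (mainTerms bv) facts.2 bv`.  No `sorry` of its own; closed exactly
when the seven stubs are. [this line] -/
theorem TypeI2Dilated_of :
    Summit.Parity.GeneralizedHardyLittlewood.Theses.LiouvilleShiftedTables.TypeI2Dilated :=
  (show DilatedTypeII → DilatedMainTerms → DilatedDivisorAP →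
      Summit.Parity.GeneralizedHardyLittlewood.Theses.LiouvilleShiftedTables.BVLiouville →
      Summit.Parity.GeneralizedHardyLittlewood.Theses.LiouvilleShiftedTables.TypeI2Dilated
      from (show URBound → AssembleStep from stub_assembleFrom) stub_uRBound)
    ((show DilatedTypeIICore → DilatedTypeII from stub_window)
      ((show DrappeauTypeII → DilatedTypeIICore from stub_peel) stub_facts.1))
    ((show Summit.Parity.GeneralizedHardyLittlewood.Theses.LiouvilleShiftedTables.BVLiouville →
        DilatedMainTerms from stub_mainTerms) stub_bvLiouville)
    stub_facts.2 stub_bvLiouville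

/-- The hypothetical form of the composition — pure logic in the seven stub STATEMENTS (an `example`, so that
`TypeI2Dilated_of` stays the unique declaration concluding the crux). -/
example :
    LineFacts → Summit.Parity.GeneralizedHardyLittlewood.Theses.LiouvilleShiftedTables.BVLiouville →
    PeelStep → WindowStep → MainTermsStep → URBound → AssembleFrom →
    Summit.Parity.GeneralizedHardyLittlewood.Theses.LiouvilleShiftedTables.TypeI2Dilated :=
  fun hF hBV hPeel hWin hMain hU hAsm =>
    (show DilatedTypeII → DilatedMainTerms → DilatedDivisorAP →
        Summit.Parity.GeneralizedHardyLittlewood.Theses.LiouvilleShiftedTables.BVLiouville →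
        Summit.Parity.GeneralizedHardyLittlewood.Theses.LiouvilleShiftedTables.TypeI2Dilated
        from (show URBound → AssembleStep from hAsm) hU)
      ((show DilatedTypeIICore → DilatedTypeII from hWin)
        ((show DrappeauTypeII → DilatedTypeIICore from hPeel) hF.1))
      ((show Summit.Parity.GeneralizedHardyLittlewood.Theses.LiouvilleShiftedTables.BVLiouville →
          DilatedMainTerms from hMain) hBV)
      hF.2 hBV

-- audit: the conclusion is the route decl itself
#check (TypeI2Dilated_of : TypeI2Dilated)

end Summit.Parity.GeneralizedHardyLittlewood.Cruxes.TypeI2Dilated.PeelToDrappeau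

end
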